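import Summits.BirchSwinnertonDyer.Rank1Residual.P2.CongruentNumberPairsAtTwoUPlusSix
import HarnessLib

/-!
# Sub-lane «bsd-p2»: A DOOR FOR THE EVEN FAMILY `n = 2p₁⋯p_k ≡ 6 (mod 8)`, `s(n) = 1`, OVER CENSUS
# VOCABULARY (twin of the `U₃⁰` door `P2/CongruentNumberPairsAtTwoSilentFiveDoor.lean`):
# `ord_{s=1} L = 1`, rank `1`, `Ш[2^∞] = 0` and `BSD(E_n, 2) ⟺ ord₂(L′(E_n,1)/(Ω·Reg)) = 2k − 2`
# (`= 4` at `k = 3`) from ANY rank-one datum, modulo Monsky's EVEN matrix theorem `hMe` and GZK ONLY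
# (bookkeeping; 0 def; 0 facts; 0 (K))

HONEST FRAMING (sub-lane «bsd-p2», run/shared/lean/b2b/bsd-rank1-residual/p2/, verbatim in every
file): the target of record is the FULL Birch–Swinnerton-Dyer formula for EVERY analytic-rank `≤ 1`
`E/ℚ` at ALL primes INCLUDING `2`; the odd-prime class ledger is referee A's; the `2`-part is OPEN
(cells O1 = X5 ∖ CM and O12 = the CM corner) and under census by «bsd-p2». Census / instrument
output at `2` = EVIDENCE / conjecture items with held-out validation, NEVER a Literature fact;
certificates close PAIRS (one isogeny class, `p = 2`), never classes. This file asserts NO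
arithmetic fact: per-pair biconditionals whose only arithmetic inputs are the NAMED PUBLISHED FACTS
`hMe` (Monsky's `2`-descent matrix theorem, EVEN case, appendix to Heath-Brown 1994:
`HeathBrown1994.monsky_card_selmerGroup_two_even`) and `hGZK` (Gross–Zagier–Kolyvagin:
`rank_eq_analyticRank_of_analyticRank_le_one`), both already binders of the landed DOOR B6
(`P2/CongruentNumberPairsAtTwoUPlusSix.lean`).

THE FAMILY (tree facts, nothing new). For distinct odd primes `p₁, …, p_k` with
`n = 2p₁⋯p_k ≡ 6 (mod 8)`: root number `−1`; the census word «`s(n) = 1`» is Monsky's EVEN Selmer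
rank `monskySelmerRankEven p = 2k − rank M = 1` (`M = ( Aᵀ + D₂  D₋₁ ; D₂  A + D₂ )`,
`HeathBrown1994.monskyMatrixEven`), so `#Sel₂(E_n) = 8` by `hMe` and, granted rank `1`,
`Ш(E_n)[2^∞] = 0` (`primaryComponent_sha_two_eq_bot_of_card_selmerGroup_eq_eight`, Silverman X.4.2);
`#E_n(ℚ)_tors = 4` (`torsionOrder_congruentNumberCurve`), `∏_ℓ c_ℓ(E_n) = 2^{2k+2}` (`c₂ = 4`,
`c_{pᵢ} = 4`: `tamagawaProduct_congruentNumberCurve_two_mul_prod`), so `#Ш_an = x·16/2^{2k+2}` for a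
datum `L′(E_n,1) = x·Ω·Reg`. The parity of the genus sum `Σ₂′(n)` is NOT a hypothesis of the door:
it only decides whether Tian–Yuan–Zhang Thm 1.2 / U⁺ SPEAKS (`Σ₂′` odd: DOOR B6
`rankOne_sha_bsdp_two_congruentNumberCurve_of_uPlus_six` already gives `BSD(E_n, 2)`) or is SILENT
(`Σ₂′` even: the `13` even `ℓ = 3` configuration families of `p2/STRUCTURE-p2.md` v0.8 §7 — the cells
of the pre-registered run PR-P2-5; no typed door reaches them: memo `T137-TYPABILITY-C-P2-2.md`
§(x1)(ii), ATLAS-B6-2 NO-GO).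

THE DOOR (this file), UNIFORM IN `k` (chosen over `Fin 3` because every input is uniform: root
number from `n ≡ 6 (mod 8)`, torsion `4` from square-freeness, `∏c_ℓ = 2^{2k+2}`, `Ш[2^∞] = 0` from
`s(n) = 1` + rank `1`): ANY datum `x ≠ 0` gives `ord_{s=1} L(E_n, s) = 1` (root number, no fact),
rank `1` (GZK), `Ш[2^∞] = 0` (`hMe` + Silverman X.4.2) and
`BSD(E_n, 2) ⟺ ord₂ x = 0 + (2k + 2) − 4 = 2k − 2` (§2: `Fin k` form; `Fin 3` form with the literal
exponent `4`; `(p, q, r)` form). Cross-checks in the tree's currency: `k = 2` gives `ord₂ x = 2` =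
the exponent of the landed conjecture node C-P2-1 (`P2/Conjectures/CongruentNumberSilentEvenFiveAtTwo.lean`,
`CongruentSilentEvenFiveOrdTwo`, there modulo Monsky 1990 Cor 5.15 instead of `hMe` + GZK);
`2k − 2 = twoExponent n` (`twoExponent_two_mul_prod_eq`), i.e. the door's exponent is TYZ's
`L′ = 2^{2k−2}·𝓛(n)²·Ω·R` exponent exactly when `𝓛(n)` is odd. Oddness of the `pᵢ` is DERIVED from
`n ≡ 6 (mod 8)` (§1), not assumed. The census input `s(n) = 1` is KERNEL-DECIDED per pair: by the
table route `monskySelmerRankEven_eq_of_table` + `decide` (as the DOOR B6 pilots do) or from a kernel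
count `Tian2014.monskySelmerRankEven_eq_one_of_card_ker`. CONSUMERS: a kernel pair certificate on an
even `ℓ = 3` cell (an exact `L′/(Ω·Reg)`, e.g. from a Heegner point as in `P2/HeegnerIndexAtTwo.lean`)
closes `BSD(E_n, 2)` for that PAIR through this door — the certificate shape PR-P2-5's `16` cells
would consume; the TYZ-free twin of the `U₃⁰` door (`ord₂ x = 3` there, `2ℓ − 3` for odd `n`); no
conjecture file for the even families is typed (standing rule: C-P2-2 unregistered). The cell is
`openO12` (CM, `2` ramified, additive); per-pair statements close no class. Nothing booked; no mark
moved. Unit `b2b-bsdres-p2-typer` GEN 13 (p2-lead WAKE-T-140 @de181af0945b8c9e + ADDENDUM 1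
@32bd3644a313dcb8).

References: [HeathBrown1994SelmerCongruentII] Appendix (Monsky), typescript p. 41 L20–L36;
[TianYuanZhang2017] Thm 1.2, §1 (1.1); [SilvermanAEC2009] Thm X.4.2; [SilvermanATAEC1994] IV.9.4,
Table 4.1; [Miller2011LMS] Def 1.1; [KoblitzECMF1993] Ch. II §5; HOME `p2/STRUCTURE-p2.md` v0.8 §7
(PR-P2-5 STAGING); `p2/LEAD-OKS.md` T-137, T-139, T-140.
-/

noncomputable section

open scoped Classical

open Matrix WeierstrassCurve Literature.NumberTheory.EllipticCurves
  Literature.NumberTheory.EllipticCurves.Rank1Residual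
  Literature.NumberTheory.EllipticCurves.Rank1Residual.Typed
  Literature.NumberTheory.EllipticCurves.HeathBrown1994
  Literature.NumberTheory.EllipticCurves.TianYuanZhang2017

set_option autoImplicit false

namespace Summit.BirchSwinnertonDyer.Rank1Residual.P2

/-! ## §1 The even family: oddness of the primes from `n ≡ 6 (mod 8)` (no named fact) -/

section Door

variable {k : ℕ} (p : Fin k → ℕ)

/-- For `n = 2p₁⋯p_k ≡ 6 (mod 8)` the product `p₁⋯p_k` is odd, hence so is every `pᵢ` (a divisor
of an odd number). So «odd primes» need not be assumed on the `n ≡ 6 (mod 8)` family.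
[cite: HeathBrown1994SelmerCongruentII, Appendix (Monsky), typescript p. 40 L40–L42] -/
theorem odd_of_two_mul_prod_mod_eight_six {n : ℕ} (hn : 2 * ∏ i, p i = n) (h8 : n % 8 = 6) :
    ∀ i, Odd (p i) := by
  have hP : Odd (∏ i, p i) := Nat.odd_iff.mpr (by omega)
  exact fun i => hP.of_dvd_nat (Finset.dvd_prod_of_mem p (Finset.mem_univ i))

/-! ## §2 The door: `BSD(E_n, 2) ⟺ ord₂ x = 2k − 2` from any rank-one datum, modulo `hMe`, `hGZK` -/

/-- **THE EVEN DOOR OVER CENSUS VOCABULARY (binders `hMe`, `hGZK` ONLY), uniform in `k`.** For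
distinct primes `p₁, …, p_k` with `n = 2p₁⋯p_k ≡ 6 (mod 8)`, Monsky's even Selmer rank
`s(n) = monskySelmerRankEven p = 1`, and ANY rank-one datum `L′(E_n, 1) = x·Ω·Reg` with `x ∈ ℚ`,
`x ≠ 0`: `ord_{s=1} L(E_n, s) = 1` (root number `−1` + `x ≠ 0`, no fact), rank `1` (GZK),
`Ш(E_n)[2^∞] = 0` (`#Sel₂ = 2^{2+s} = 8` by `hMe` + Silverman X.4.2), and
`BSD(E_n, 2) ⟺ ord₂ x = ord₂ ∏c_ℓ − 4 = (2k + 2) − 4 = 2k − 2`. No Tian–Yuan–Zhang / U⁺ /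
Rédei–Reichardt binder; no genus-sum hypothesis. Per-pair; closes no class (cell `openO12`).
[cite: HeathBrown1994SelmerCongruentII, Appendix (Monsky), typescript p. 41 L20–L36]
[cite: SilvermanAEC2009, Thm. X.4.2] [cite: SilvermanATAEC1994, IV.9.4, Table 4.1 (PDF pp. 345–347)]
[cite: Miller2011LMS, Def. 1.1 (arXiv:1010.2431 p. 3)] -/
theorem rankOne_sha_bsdp_two_iff_congruentNumberCurve_two_mul_prod
    (hGZK : rank_eq_analyticRank_of_analyticRank_le_one) (hMe : monsky_card_selmerGroup_two_even)
    (hp : ∀ i, (p i).Prime) (hinj : Function.Injective p) {n : ℕ} (hn : 2 * ∏ i, p i = n)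
    (h8 : n % 8 = 6) (hs : monskySelmerRankEven p = 1) {x : ℚ} (hx0 : x ≠ 0)
    (hx : deriv (congruentNumberCurve n).entireLFunction 1 =
      (x : ℂ) * ((congruentNumberCurve n).realPeriodRat : ℂ) *
        ((congruentNumberCurve n).regulator : ℂ)) :
    (congruentNumberCurve n).analyticRank = 1 ∧ (congruentNumberCurve n).mordellWeilRank = 1 ∧
      AddCommGroup.primaryComponent (congruentNumberCurve n).sha 2 = ⊥ ∧
      (BSDp (congruentNumberCurve n) 2 ↔ padicValRat 2 x = 2 * (k : ℤ) - 2) := by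
  have hodd : ∀ i, Odd (p i) := odd_of_two_mul_prod_mod_eight_six p hn h8
  have hsq : Squarefree n := hn ▸ squarefree_two_mul_prod_of_injective p hp hodd hinj
  have hn0 : n ≠ 0 := hsq.ne_zero
  haveI := isElliptic_congruentNumberCurve hn0
  haveI : Fact (Nat.Prime 2) := ⟨Nat.prime_two⟩
  -- root number `−1` and `x ≠ 0`: `ord_{s=1} L = 1` (no named fact)
  have hΩ : ((congruentNumberCurve n).realPeriodRat : ℂ) ≠ 0 := by
    exact_mod_cast (congruentNumberCurve n).realPeriodRat_pos_holds.ne'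
  have hR : ((congruentNumberCurve n).regulator : ℂ) ≠ 0 := by
    exact_mod_cast (congruentNumberCurve n).regulator_pos'.ne'
  have hder : deriv (congruentNumberCurve n).entireLFunction 1 ≠ 0 := by
    rw [hx]
    exact mul_ne_zero (mul_ne_zero (by exact_mod_cast hx0) hΩ) hR
  have hr1 : (congruentNumberCurve n).analyticRank = 1 :=
    analyticRank_congruentNumberCurve_eq_one_of_deriv_ne_zero hsq (Or.inr (Or.inl h8)) hder
  -- GZK: rank `1`; Monsky (even case) + `s(n) = 1`: `#Sel₂ = 8`; hence `Ш[2^∞] = 0`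
  obtain ⟨hrank, -⟩ := hGZK (congruentNumberCurve n) (le_of_eq hr1)
  rw [hr1] at hrank
  have hsel : Nat.card ((congruentNumberCurve n).selmerGroup 2) = 8 := by
    subst hn
    rw [hMe k p hp hodd hinj, hs]
    norm_num
  have hbot := primaryComponent_sha_two_eq_bot_of_card_selmerGroup_eq_eight hn0 hrank hsel
  refine ⟨hr1, hrank, hbot, ?_⟩
  rw [bsdp_two_iff_of_LDerivOverOmegaReg_of_sha_two_eq_bot_of_torsionOrder_eq_four
    (congruentNumberCurve n) hGZK hr1 hx hbot (torsionOrder_congruentNumberCurve hsq),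
    tamagawaProduct_congruentNumberCurve_two_mul_prod p hp hodd hinj hn, padicValNat.prime_pow]
  push_cast
  omega

end Door

/-! ## §3 Three primes: the literal exponent `4` (`Fin 3` form and `(p, q, r)` form) -/

section ThreePrimes

/-- **THE EVEN `ℓ = 3` DOOR, `Fin 3` form over census vocabulary.** For distinct primes
`p₀, p₁, p₂` with `n = 2p₀p₁p₂ ≡ 6 (mod 8)`, `monskySelmerRankEven p = 1`, and ANY rank-one datum
`L′(E_n, 1) = x·Ω·Reg`, `x ≠ 0`: `ord_{s=1} L = 1`, rank `1`, `Ш[2^∞] = 0`, and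
`BSD(E_n, 2) ⟺ ord₂ x = 4` (`= 2·3 − 2`; `#Ш_an = x·16/2⁸ = x/16` a `2`-adic unit) — modulo `hMe`,
`hGZK` only. The shape the `16` even `ℓ = 3` cells of PR-P2-5 would consume.
[cite: HeathBrown1994SelmerCongruentII, Appendix (Monsky), typescript p. 41 L20–L36]
[cite: Miller2011LMS, Def. 1.1 (arXiv:1010.2431 p. 3)] -/
theorem rankOne_sha_bsdp_two_iff_congruentNumberCurve_two_mul_three_primes
    (hGZK : rank_eq_analyticRank_of_analyticRank_le_one) (hMe : monsky_card_selmerGroup_two_even)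
    (p : Fin 3 → ℕ) (hp : ∀ i, (p i).Prime) (hinj : Function.Injective p) {n : ℕ}
    (hn : 2 * ∏ i, p i = n) (h8 : n % 8 = 6) (hs : monskySelmerRankEven p = 1) {x : ℚ}
    (hx0 : x ≠ 0)
    (hx : deriv (congruentNumberCurve n).entireLFunction 1 =
      (x : ℂ) * ((congruentNumberCurve n).realPeriodRat : ℂ) *
        ((congruentNumberCurve n).regulator : ℂ)) :
    (congruentNumberCurve n).analyticRank = 1 ∧ (congruentNumberCurve n).mordellWeilRank = 1 ∧
      AddCommGroup.primaryComponent (congruentNumberCurve n).sha 2 = ⊥ ∧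
      (BSDp (congruentNumberCurve n) 2 ↔ padicValRat 2 x = 4) := by
  have h := rankOne_sha_bsdp_two_iff_congruentNumberCurve_two_mul_prod p hGZK hMe hp hinj hn h8 hs
    hx0 hx
  norm_num at h
  exact h

/-- **THE EVEN `ℓ = 3` DOOR, `(p, q, r)` form.** For pairwise distinct primes `p, q, r` with
`2pqr ≡ 6 (mod 8)`, `monskySelmerRankEven ![p, q, r] = 1`, and ANY rank-one datum
`L′(E_{2pqr}, 1) = x·Ω·Reg`, `x ≠ 0`: `ord_{s=1} L = 1`, rank `1`, `Ш[2^∞] = 0`, and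
`BSD(E_{2pqr}, 2) ⟺ ord₂ x = 4` — modulo `hMe`, `hGZK` only.
[cite: HeathBrown1994SelmerCongruentII, Appendix (Monsky), typescript p. 41 L20–L36]
[cite: Miller2011LMS, Def. 1.1 (arXiv:1010.2431 p. 3)] -/
theorem rankOne_sha_bsdp_two_iff_congruentNumberCurve_two_mul_pqr
    (hGZK : rank_eq_analyticRank_of_analyticRank_le_one) (hMe : monsky_card_selmerGroup_two_even)
    {p q r : ℕ} (hp : p.Prime) (hq : q.Prime) (hr : r.Prime) (hpq : p ≠ q) (hpr : p ≠ r)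
    (hqr : q ≠ r) (h8 : 2 * (p * q * r) % 8 = 6) (hs : monskySelmerRankEven ![p, q, r] = 1)
    {x : ℚ} (hx0 : x ≠ 0)
    (hx : deriv (congruentNumberCurve (2 * (p * q * r))).entireLFunction 1 =
      (x : ℂ) * ((congruentNumberCurve (2 * (p * q * r))).realPeriodRat : ℂ) *
        ((congruentNumberCurve (2 * (p * q * r))).regulator : ℂ)) :
    (congruentNumberCurve (2 * (p * q * r))).analyticRank = 1 ∧
      (congruentNumberCurve (2 * (p * q * r))).mordellWeilRank = 1 ∧
      AddCommGroup.primaryComponent (congruentNumberCurve (2 * (p * q * r))).sha 2 = ⊥ ∧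
      (BSDp (congruentNumberCurve (2 * (p * q * r))) 2 ↔ padicValRat 2 x = 4) := by
  have ht : ∀ i, (![p, q, r] i).Prime := fun i => by fin_cases i <;> assumption
  have hinj : Function.Injective ![p, q, r] := by
    intro i j h
    fin_cases i <;> fin_cases j <;> simp_all
  have hn : 2 * ∏ i, ![p, q, r] i = 2 * (p * q * r) := by rw [Fin.prod_univ_three]; rfl
  exact rankOne_sha_bsdp_two_iff_congruentNumberCurve_two_mul_three_primes hGZK hMe _ ht hinj hn h8 hs
    hx0 hx

end ThreePrimes

end Summit.BirchSwinnertonDyer.Rank1Residual.P2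

end
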